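import Literature.MathematicalPhysics.QuantumFieldTheory.Balaban1983to89.B7Prop2Explicit
import HarnessLib

/-!
# T⁴ programme, node NE3 — the kinematic refinement lemma, leaf R1e (file 1/3): THE STAIRCASE STOKES IDENTITY AND
# THE FIRST MOMENT OF THE BLOCK for the loops of Bałaban's average (42)

NE3 formalisation swarm of the cell `pub-balaban`, crew seat `b2b-balaban-t4-ne3-formalise-leaf-08` (row S4e of
`t4/formal/NE3/LEAVES.md`; owner skeleton `t4/b2b-balaban-t4-ne3-p1/SKELETON-NE3-P1.md` v1.1, §3 leaf R1e «loop-log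
prediction … by non-abelian Stokes over loops of area ≤ dL²»).

CONTEXT.  The owner's re-cut of the refinement hypothesis (H2) of NE3(A) (`Support/MinimalActionRefine`, shape
`SmoothRefine`) asks for a KINEMATIC lemma: a slowly varying small field on the `η`-lattice is the exact block average
(42) of a slowly varying small field on the `η/L`-lattice.  Its plan (skeleton §2 ¶3): R1 an approximate covariant
refinement whose straight-line transporters are PRE-COMPENSATED by the first moment of the loop fluxes of (42), then R2
an exact chain-end correction (`Support/ChainEndContraction`, leaf R2a, in the tree).  The analytic heart of R1 is the
LOOP-LOG PREDICTION, proved generically in files 2–3 (`BlockAverageLoopLogCore.norm_Xavg_sub_Xfirst_le`,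
`BlockAverageLoopLog.loopLog_of_regular`): for ANY fine configuration `W` with plaquettes within `a` of `1` and
covariant flux gradient `≤ g` pointwise, the exponent `X_c = Σ_{x ∈ B(c₋)} L^{−d} log W(Γ_{c,x})W(c)⁻¹` of (42) is,
up to `20 d L² θ² + d(d+1)L³ g` (`θ = 8(d+1)(d+4)L²a`), the FIRST-MOMENT exponent
`X¹_c = (L(L−1)/2) · Σ_m log W(∂p_{c₋; m, κ})` — so a configuration whose straight-line transporters are pre-compensated
by `exp(−X¹_c)` averages to its target up to that error (the MISMATCH that R2 then removes).

THIS FILE (1/3) supplies the exact identities and the bookkeeping behind it, over the tree's own words (B7 =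
[Balaban1985Averaging]: `B7Prop1Explicit.hol` (9), `seg`, `treeWord` (B5 (1.7)), `gammaWord` (14), `boxVec`, the
abelian contour functional `asum` and the rectangle Stokes formula (48) `stokes`):
 * §1 THE STAIRCASE STOKES IDENTITY `asum_loop_eq_stairSum`: the abelian contour functional of the loop
   `Γ_{c,x} ∪ (−Γ_c)`, `x = c₋ + r`, is the sum of `A(∂p)` over the STAIRCASE SURFACE between the tree word `Γ_{c₋,x}`
   and its translate by `Le_κ` — `L·r_m` plaquettes of the plane `{m, κ}` for each direction `m` (none for `m = κ`),
   obtained by telescoping the tree's `asum_rectWord` along the segments of the tree word and applying `stokes` to each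
   rectangle;
 * §2 THE FIRST MOMENT OF THE BLOCK `Σ_{r ∈ [0,L)^d} r_m = L^d(L−1)/2` (pair `r` with its reflection `r_m ↦ L−1−r_m`),
   whence the averaging weights of (42) against the staircase lengths give `Σ_r L^{−d}·(L·r_m) = L(L−1)/2`;
 * §3 two bookkeeping estimates: a staircase sum against a constant plaquette value (`norm_stairSum_sub_stairMain_le`:
   error `(Σ_m r_m)·L·δ` if every swept `A(∂p)` is within `δ` of the value) and the drift of a site function along a word
   from per-bond steps (`norm_sub_le_of_steps`).

HONEST FRAMING.  Lattice combinatorics of (42) (finite-T⁴ rung (B)+1 bookkeeping of the cell's ladder); nothing here is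
an estimate on a minimiser; no conditional of the cell (`BetaPertH`, (B), (B^μ)) is used or hidden; nothing bears on
infinite volume, a mass gap, or the Clay problem; **NE3 is NOT proved** (this serves leaf R1e of the UNPROVED kinematic
lemma `SmoothRefine`, which is OURS; its leaves R1a–d and the glue R0 remain open).  ABSOLUTE RULE of the cell kept: no
printed sentence is a hypothesis of any declaration — B7/B5 are quoted for what they DEFINE ((9), (14), (42), (48),
(1.7)); no `sorry`, no axioms beyond Mathlib's.  PLACEMENT (human rule 2026-08-19): cell work under
`Summits/QuantumFields/BalabanUV/`; imports the tree's Literature module `B7Prop2Explicit` only; moves nothing.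
Records: `t4/formal/NE3/LEAVES.md` row S4e; CLAIMS.log «CLAIM NE3-S4e» (l.7127) of the cell `pub-balaban`.
-/

set_option autoImplicit false

open scoped BigOperators
open NormedSpace Finset

namespace Summit.QuantumFields.BalabanUV.T4Continuum.BlockAverageLoopLogPrep

open Literature.MathematicalPhysics.QuantumFieldTheory.Balaban1983to89
open B7Prop1Explicit B7Prop2Explicit

noncomputable section

variable {d : ℕ}

/-! ## §1 The staircase Stokes identity for the loops of (42) -/

section Staircase

variable {𝔸 : Type*} [NormedRing 𝔸]

/-- The staircase word of a list of directions `ms` with step counts `v`: the concatenation of the straight segments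
`seg m (v m)`, `m ∈ ms` (for `ms = [d−1, …, 0]` and `v = r` this is the tree word `Γ_{q, q+r}` of B5 (1.7)). [folklore] -/
def stairWord (v : Fin d → ℕ) (ms : List (Fin d)) : List (Letter d) :=
  ms.flatMap fun m => seg m ((v m : ℕ) : ℤ)

/-- The staircase sum: for each direction `m ∈ ms` (base point advanced along the previous segments) the abelian
plaquette functional `A(∂p)` summed over the `v m × L` rectangle spanned by the segment and `L e_κ`. [folklore] -/
def stairSum (A : Site d → Fin d → 𝔸) (κ : Fin d) (L : ℕ) (v : Fin d → ℕ) : Site d → List (Fin d) → 𝔸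
  | _, [] => 0
  | q, m :: ms =>
      (∑ i ∈ range (v m), ∑ j ∈ range L, asum A (q + (i : ℤ) • e m + (j : ℤ) • e κ) (plaqWord m κ))
        + stairSum A κ L v (q + ((v m : ℕ) : ℤ) • e m) ms

omit [NormedRing 𝔸] in
/-- `stairWord_nil`: bookkeeping. [folklore] -/
@[simp] theorem stairWord_nil (v : Fin d → ℕ) : stairWord v [] = [] := rfl

omit [NormedRing 𝔸] in
/-- `stairWord_cons`: bookkeeping. [folklore] -/
theorem stairWord_cons (v : Fin d → ℕ) (m : Fin d) (ms : List (Fin d)) :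
    stairWord v (m :: ms) = seg m ((v m : ℕ) : ℤ) ++ stairWord v ms := by
  simp [stairWord]

/-- `stairSum_nil`: bookkeeping. [folklore] -/
@[simp] theorem stairSum_nil (A : Site d → Fin d → 𝔸) (κ : Fin d) (L : ℕ) (v : Fin d → ℕ) (q : Site d) :
    stairSum A κ L v q [] = 0 := rfl

/-- `stairSum_cons`: bookkeeping. [folklore] -/
theorem stairSum_cons (A : Site d → Fin d → 𝔸) (κ : Fin d) (L : ℕ) (v : Fin d → ℕ) (q : Site d) (m : Fin d)
    (ms : List (Fin d)) :
    stairSum A κ L v q (m :: ms) =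
      (∑ i ∈ range (v m), ∑ j ∈ range L, asum A (q + (i : ℤ) • e m + (j : ℤ) • e κ) (plaqWord m κ))
        + stairSum A κ L v (q + ((v m : ℕ) : ℤ) • e m) ms := rfl

/-- **THE STAIRCASE STOKES IDENTITY**: for the staircase word `W` from `q`,
`A(W) + A([q + disp W, + L e_κ]) − A(W + L e_κ) − A([q, q + L e_κ]) = Σ_{m ∈ ms} Σ_{p ⊂ R_m} A(∂p)` — the boundary of
the staircase surface between `W` and its translate by `L e_κ` is the telescoping sum of the rectangle boundaries
(`asum_rectWord`), and each rectangle is the tree's abelian Stokes formula `stokes`. [folklore] -/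
theorem stair_stokes (A : Site d → Fin d → 𝔸) (κ : Fin d) (L : ℕ) (v : Fin d → ℕ) :
    ∀ (ms : List (Fin d)) (q : Site d),
      asum A q (stairWord v ms) + asum A (q + disp (stairWord v ms)) (seg κ L)
        - asum A (q + (L : ℤ) • e κ) (stairWord v ms) - asum A q (seg κ L) = stairSum A κ L v q ms
  | [], q => by simp
  | m :: ms, q => by
    have ih := stair_stokes A κ L v ms (q + ((v m : ℕ) : ℤ) • e m)
    rw [stairSum_cons, ← ih, ← stokes, asum_rectWord, stairWord_cons, asum_append, asum_append, disp_append,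
      disp_seg]
    rw [show q + (L : ℤ) • e κ + ((v m : ℕ) : ℤ) • e m = q + ((v m : ℕ) : ℤ) • e m + (L : ℤ) • e κ by abel,
      show q + (((v m : ℕ) : ℤ) • e m + disp (stairWord v ms)) = q + ((v m : ℕ) : ℤ) • e m + disp (stairWord v ms)
        by abel]
    abel

omit [NormedRing 𝔸] in
/-- The tree word of a block offset is the staircase word of the directions `d−1, …, 0` (B5 (1.7): the last coordinate
is changed first). [folklore] -/
theorem treeWord_boxVec (L : ℕ) (r : Fin d → Fin L) :
    treeWord (boxVec L r) = stairWord (fun m => (r m : ℕ)) (List.finRange d).reverse := rfl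

/-- **The contour sum of one loop of (42) is a staircase sum**: `A(Γ_{c,x} ∪ (−Γ_c)) = Σ_m Σ_{p ⊂ R_m(x)} A(∂p)`,
`x = q + r`, the plaquettes `p` running over the staircase surface between the tree word `Γ_{q,x}` and its translate
by `L e_κ` (`L·r_m` plaquettes of the plane `{m, κ}` for each `m`; none for `m = κ`, where `A(∂p) = 0`). [folklore] -/
theorem asum_loop_eq_stairSum (A : Site d → Fin d → 𝔸) (L : ℕ) (q : Site d) (κ : Fin d) (r : Fin d → Fin L) :
    asum A q (gammaWord L κ (boxVec L r) ++ seg κ (-(L : ℤ)))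
      = stairSum A κ L (fun m => (r m : ℕ)) q (List.finRange d).reverse := by
  rw [asum_append, disp_gammaWord, asum_seg_neg, add_sub_cancel_right, ← sub_eq_add_neg, asum_gammaWord,
    ← stair_stokes, ← treeWord_boxVec, disp_treeWord]

end Staircase

/-! ## §2 The first moment of the block: `Σ_{r ∈ [0,L)^d} r_m = L^d (L − 1)/2` -/

section FirstMoment

/-- Reflecting the `m`-th coordinate of a block offset, `r_m ↦ L − 1 − r_m`. [folklore] -/
def reflectAt (L : ℕ) (m : Fin d) (r : Fin d → Fin L) : Fin d → Fin L :=
  Function.update r m (Fin.rev (r m))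

/-- `reflectAt` is an involution. [folklore] -/
theorem reflectAt_involutive (L : ℕ) (m : Fin d) : Function.Involutive (reflectAt (d := d) L m) := by
  intro r
  unfold reflectAt
  rw [Function.update_idem, Function.update_self, Fin.rev_rev, Function.update_eq_self]

/-- `reflectAt_apply_self`: bookkeeping. [folklore] -/
theorem reflectAt_apply_self (L : ℕ) (m : Fin d) (r : Fin d → Fin L) : reflectAt L m r m = Fin.rev (r m) := by
  simp [reflectAt]

/-- **The first moment of a coordinate over the block**: `Σ_{r ∈ [0,L)^d} r_m = L^d (L − 1) / 2` (pair `r` with its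
reflection in the `m`-th coordinate). [folklore] -/
theorem sum_coord_eq (L : ℕ) (m : Fin d) :
    ∑ r : Fin d → Fin L, ((r m : ℕ) : ℝ) = (L : ℝ) ^ d * ((L : ℝ) - 1) / 2 := by
  set σ := Function.Involutive.toPerm (reflectAt (d := d) L m) (reflectAt_involutive L m) with hσ
  have h1 : ∑ r : Fin d → Fin L, ((r m : ℕ) : ℝ) = ∑ r : Fin d → Fin L, (((σ r) m : ℕ) : ℝ) :=
    (Equiv.sum_comp σ (fun r : Fin d → Fin L => ((r m : ℕ) : ℝ))).symm
  have h2 : ∀ r : Fin d → Fin L, (((σ r) m : ℕ) : ℝ) = ((L : ℝ) - 1) - ((r m : ℕ) : ℝ) := by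
    intro r
    rw [hσ, Function.Involutive.coe_toPerm, reflectAt_apply_self, Fin.val_rev]
    have h := (r m).isLt
    rw [Nat.cast_sub (by omega), Nat.cast_add, Nat.cast_one]
    ring
  have h3 : ∑ r : Fin d → Fin L, (((σ r) m : ℕ) : ℝ)
      = (L : ℝ) ^ d * ((L : ℝ) - 1) - ∑ r : Fin d → Fin L, ((r m : ℕ) : ℝ) := by
    rw [Finset.sum_congr rfl fun r _ => h2 r, Finset.sum_sub_distrib, Finset.sum_const, Finset.card_univ,
      Fintype.card_fun, Fintype.card_fin, Fintype.card_fin, nsmul_eq_mul, Nat.cast_pow]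
  rw [h3] at h1
  linarith

/-- The averaging weights `L^{−d}` against the staircase lengths `L·r_m`: `Σ_r L^{−d} (r_m · L) = L(L−1)/2` — the
FIRST MOMENT of Bałaban's block average (42). [folklore] -/
theorem avg_mul_coord_eq (L : ℕ) (hL : 1 ≤ L) (m : Fin d) :
    ∑ r : Fin d → Fin L, ((L : ℝ) ^ d)⁻¹ * (((r m : ℕ) : ℝ) * L) = (L : ℝ) * ((L : ℝ) - 1) / 2 := by
  have hL0 : ((L : ℝ)) ^ d ≠ 0 := pow_ne_zero _ (by exact_mod_cast (by omega : L ≠ 0))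
  rw [← Finset.mul_sum, ← Finset.sum_mul, sum_coord_eq]
  field_simp

end FirstMoment

/-! ## §3 Two bookkeeping estimates: the staircase sum against a constant plaquette value, and the drift of a
plaquette function along a word -/

section Bookkeeping

/-- The sum of the step counts of a list of directions. [folklore] -/
def stepTotal (v : Fin d → ℕ) (ms : List (Fin d)) : ℕ := (ms.map v).sum

/-- `stepTotal_nil`: bookkeeping. [folklore] -/
@[simp] theorem stepTotal_nil (v : Fin d → ℕ) : stepTotal v [] = 0 := rfl

/-- `stepTotal_cons`: bookkeeping. [folklore] -/
@[simp] theorem stepTotal_cons (v : Fin d → ℕ) (m : Fin d) (ms : List (Fin d)) :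
    stepTotal v (m :: ms) = v m + stepTotal v ms := by
  simp [stepTotal]

section Main

variable {𝔸 : Type*} [NormedRing 𝔸] [NormedAlgebra ℂ 𝔸]

/-- The main (first-moment) term of a staircase sum: `Σ_{m ∈ ms} (v m · L) • Φ m`. [folklore] -/
def stairMain (L : ℕ) (v : Fin d → ℕ) (Φ : Fin d → 𝔸) : List (Fin d) → 𝔸
  | [] => 0
  | m :: ms => (((v m : ℕ) : ℝ) * L) • Φ m + stairMain L v Φ ms

/-- `stairMain_nil`: bookkeeping. [folklore] -/
@[simp] theorem stairMain_nil (L : ℕ) (v : Fin d → ℕ) (Φ : Fin d → 𝔸) : stairMain L v Φ [] = 0 := rfl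

/-- `stairMain_cons`: bookkeeping. [folklore] -/
theorem stairMain_cons (L : ℕ) (v : Fin d → ℕ) (Φ : Fin d → 𝔸) (m : Fin d) (ms : List (Fin d)) :
    stairMain L v Φ (m :: ms) = (((v m : ℕ) : ℝ) * L) • Φ m + stairMain L v Φ ms := rfl

/-- Over the full list of directions the main term is the `Finset.univ` sum. [folklore] -/
theorem stairMain_finRange_reverse (L : ℕ) (v : Fin d → ℕ) (Φ : Fin d → 𝔸) :
    stairMain L v Φ (List.finRange d).reverse = ∑ m : Fin d, (((v m : ℕ) : ℝ) * L) • Φ m := by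
  have h : ∀ ms : List (Fin d), stairMain L v Φ ms = (ms.map fun m => (((v m : ℕ) : ℝ) * L) • Φ m).sum := by
    intro ms
    induction ms with
    | nil => rfl
    | cons m ms ih => rw [stairMain_cons, ih, List.map_cons, List.sum_cons]
  rw [h, List.map_reverse, List.sum_reverse, Fin.sum_univ_def]

/-- **The staircase sum against a constant plaquette value**: if on the `ℓ¹`-ball of radius `D` around `q₀` every
plaquette functional `A(∂p)` of the plane `{m, κ}` is within `δ` of `Φ m`, then a staircase sum started at `q` whose
plaquettes stay in that ball is within `(Σ_m v m) · L · δ` of its main term `Σ_m (v m · L) • Φ m`. [folklore] -/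
theorem norm_stairSum_sub_stairMain_le (A : Site d → Fin d → 𝔸) (κ : Fin d) (L : ℕ) (v : Fin d → ℕ)
    (Φ : Fin d → 𝔸) (q₀ : Site d) (D : ℕ) {δ : ℝ} (hδ : 0 ≤ δ)
    (hΦ : ∀ (x : Site d) (m : Fin d), l1 (x - q₀) ≤ D → ‖asum A x (plaqWord m κ) - Φ m‖ ≤ δ) :
    ∀ (ms : List (Fin d)) (q : Site d), l1 (q - q₀) + stepTotal v ms + L ≤ D + 1 →
      ‖stairSum A κ L v q ms - stairMain L v Φ ms‖ ≤ (stepTotal v ms : ℝ) * L * δ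
  | [], q, _ => by simp
  | m :: ms, q, hq => by
    rw [stepTotal_cons] at hq
    have hq' : l1 (q + ((v m : ℕ) : ℤ) • e m - q₀) + stepTotal v ms + L ≤ D + 1 := by
      have h1 := l1_add_le (q - q₀) (((v m : ℕ) : ℤ) • e m)
      rw [l1_zsmul_e, Int.natAbs_natCast, show q - q₀ + ((v m : ℕ) : ℤ) • e m = q + ((v m : ℕ) : ℤ) • e m - q₀
        by abel] at h1
      omega
    have ih := norm_stairSum_sub_stairMain_le A κ L v Φ q₀ D hδ hΦ ms _ hq'
    rw [stairSum_cons, stairMain_cons, stepTotal_cons, Nat.cast_add, add_mul, add_mul,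
      show ∀ a b c e : 𝔸, a + b - (c + e) = (a - c) + (b - e) by intros; abel]
    refine (norm_add_le _ _).trans (add_le_add ?_ ih)
    -- the rectangle of `v m × L` plaquettes, each within `δ` of `Φ m`
    have hrect : (((v m : ℕ) : ℝ) * L) • Φ m = ∑ i ∈ range (v m), ∑ j ∈ range L, Φ m := by
      rw [Finset.sum_const, Finset.sum_const, Finset.card_range, Finset.card_range, ← mul_nsmul',
        ← Nat.cast_smul_eq_nsmul ℝ, Nat.cast_mul]
    rw [hrect, ← Finset.sum_sub_distrib]
    simp_rw [← Finset.sum_sub_distrib]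
    calc _ ≤ ∑ i ∈ range (v m), ‖∑ j ∈ range L, (asum A (q + (i : ℤ) • e m + (j : ℤ) • e κ) (plaqWord m κ) - Φ m)‖ :=
          norm_sum_le _ _
      _ ≤ ∑ i ∈ range (v m), ∑ j ∈ range L, ‖asum A (q + (i : ℤ) • e m + (j : ℤ) • e κ) (plaqWord m κ) - Φ m‖ :=
          Finset.sum_le_sum fun i _ => norm_sum_le _ _
      _ ≤ ∑ i ∈ range (v m), ∑ j ∈ range L, δ := by
          refine Finset.sum_le_sum fun i hi => Finset.sum_le_sum fun j hj => hΦ _ m ?_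
          rw [Finset.mem_range] at hi hj
          have h1 := l1_add_le (q - q₀) ((i : ℤ) • e m + (j : ℤ) • e κ)
          have h2 := l1_add_le ((i : ℤ) • e m) ((j : ℤ) • e κ)
          rw [l1_zsmul_e, l1_zsmul_e, Int.natAbs_natCast, Int.natAbs_natCast] at h2
          rw [show q - q₀ + ((i : ℤ) • e m + (j : ℤ) • e κ) = q + (i : ℤ) • e m + (j : ℤ) • e κ - q₀ by abel] at h1
          omega
      _ = ((v m : ℕ) : ℝ) * L * δ := by
          rw [Finset.sum_const, Finset.sum_const, Finset.card_range, Finset.card_range, nsmul_eq_mul, nsmul_eq_mul]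
          ring

end Main

variable {𝔸 : Type*} [NormedRing 𝔸]

/-- **Drift of a site function along a word**: if `‖G(p + e_μ) − G(p)‖ ≤ ε` for every bond with both endpoints in the
`ℓ¹`-ball of radius `D` around `q₀`, then along any word `w` from `p` that stays in the ball,
`‖G(p + disp w) − G(p)‖ ≤ |w| · ε`. [folklore] -/
theorem norm_sub_le_of_steps (G : Site d → 𝔸) (q₀ : Site d) (D : ℕ) {ε : ℝ} (hε : 0 ≤ ε)
    (hstep : ∀ (p : Site d) (μ : Fin d), l1 (p - q₀) ≤ D → l1 (p + e μ - q₀) ≤ D → ‖G (p + e μ) - G p‖ ≤ ε) :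
    ∀ (w : List (Letter d)) (p : Site d), l1 (p - q₀) + w.length ≤ D →
      ‖G (p + disp w) - G p‖ ≤ w.length * ε
  | [], p, _ => by simp
  | l :: w, p, hp => by
    rw [List.length_cons] at hp
    have hpl : l1 (p + l.vec - q₀) ≤ l1 (p - q₀) + 1 := by
      have := l1_add_le (p - q₀) l.vec
      rw [l1_vec, show p - q₀ + l.vec = p + l.vec - q₀ by abel] at this
      exact this
    have ih := norm_sub_le_of_steps G q₀ D hε hstep w (p + l.vec) (by omega)
    have hl : ‖G (p + l.vec) - G p‖ ≤ ε := by
      obtain ⟨μ, b⟩ := l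
      cases b
      · -- backward letter: the bond `⟨p − e_μ, p⟩`
        have hv : p + Letter.vec (μ, false) = p - e μ := by simp [Letter.vec, sub_eq_add_neg]
        rw [hv] at hpl ⊢
        have h := hstep (p - e μ) μ (by omega) (by rw [sub_add_cancel]; omega)
        rw [sub_add_cancel] at h
        rwa [norm_sub_rev]
      · have hv : p + Letter.vec (μ, true) = p + e μ := by simp [Letter.vec]
        rw [hv] at hpl ⊢
        exact hstep p μ (by omega) (by omega)
    rw [disp_cons, List.length_cons, Nat.cast_succ, add_mul, one_mul, ← add_assoc]
    calc ‖G (p + l.vec + disp w) - G p‖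
        = ‖(G (p + l.vec + disp w) - G (p + l.vec)) + (G (p + l.vec) - G p)‖ := by rw [sub_add_sub_cancel]
      _ ≤ _ := norm_add_le _ _
      _ ≤ w.length * ε + ε := add_le_add ih hl

end Bookkeeping

end

end Summit.QuantumFields.BalabanUV.T4Continuum.BlockAverageLoopLogPrep
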